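import Literature.NumberTheory.Automorphic.StableCentralizerEquivCM
import Literature.NumberTheory.Rogawski1990.AdelicStableConjugacyG
import HarnessLib

/-!
# The adelic stable-centraliser isomorphism is COMPONENTWISE the local ∕ archimedean one
(Rogawski, *Automorphic representations of unitary groups in three variables* (1990), §4.3 pp. 43–44: the Haar measures on stably conjugate tori are fixed
compatibly, place by place, and `dt = ⊗_v dt_v` globally; §14.5 pp. 237–238)

Topic `NumberTheory/Automorphic`; namespace `Literature.NumberTheory.Automorphic.UnitaryGroup`.  THEOREMS ONLY (no definition, no named fact, no instance, no
`sorry`).  Sequel of ★ `StableCentralizerEquivCM` (F0P3a-p04 (g3), (S-B) of road (M-C) «measure coherence»): there, for rational `γ ∈ U(H)(L⁺)`,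
`γ′ ∈ U(H′)(L⁺)` corresponding over `L` with `γ` regular, the isomorphisms `adelicStableCentralizerEquiv : Z_{U(H)(𝔸)}(γ ⊗ 1) ≃ₜ* Z_{U(H′)(𝔸)}(γ′ ⊗ 1)`,
`localStableCentralizerEquiv` (one finite place) and `archStableCentralizerEquiv` (`L ⊗ ℝ`) are built SEPARATELY, each as conjugation by some conjugator and
each INDEPENDENT of the conjugator.  Here: they are COMPATIBLE with the projections — the road (M-C-4)(b3) input «`e_𝔸` is `(e_∞, (e_v)_v)` on the restricted
product» (A-p06 (g19) census (δ4)):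

* `toLocal_mem_centralizer_toLocal_toAdelic`, `archPart_mem_centralizer_cmRationalToArch` — the projections `z ↦ z_v` (★ `cmDatum.toLocal`) and `z ↦ z_∞`
  (★ `UnitaryGroup.archPart`, with ★ `archPart_cmDatum_toAdelic : (γ ⊗ 1)_∞ = cmRationalToArch γ`) map `Z_{U(H)(𝔸)}(γ ⊗ 1)` into `Z_{U(H)(L⁺_v)}((γ ⊗ 1)_v)`,
  `Z_{U(H)(L⁺ ⊗ ℝ)}(γ ⊗ 1)`;
* **`toLocal_adelicStableCentralizerEquiv`** — `(e_𝔸 z)_v = e_v (z_v)`, where `e_v = localStableCentralizerEquiv` for the localised correspondence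
  ★ `corresponds_toLocal_toAdelic` (both sides are conjugation by `(y ⊗ 1)_v` for a rational conjugator `y`: ★ `coe_adelicStableCentralizerEquiv_eq_of_conj_eq`,
  ★ `coe_localStableCentralizerEquiv_eq_of_conj_eq`);
* **`archPart_adelicStableCentralizerEquiv`** — `(e_𝔸 z)_∞ = e_∞ (z_∞)`, `e_∞ = archStableCentralizerEquiv` for ★ `corresponds_cmRationalToArch`.
The local ∕ archimedean regularity hypotheses (`IsRegularElt` of `(γ ⊗ 1)_v`, of `γ ⊗ 1 ∈ U(H)(L ⊗ ℝ)`) are taken as binders (they follow from the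
rational one by `Matrix.charpoly_map` + `Polynomial.Separable.map`; supplied by the consumer's regularity-localisation lemmas).

## References
* J. D. Rogawski, *Automorphic Representations of Unitary Groups in Three Variables*, Ann. of Math. Stud. 123 (1990), §4.3 pp. 43–44, §14.5 pp. 237–238
  [Rogawski1990].
* A. Borel, H. Jacquet, *Automorphic forms and automorphic representations*, Proc. Sympos. Pure Math. 33.1 (1979), §4.1 [BorelJacquet1979].
-/

noncomputable section

open NumberField IsDedekindDomain
open scoped Matrix MatrixGroups

namespace Literature.NumberTheory.Automorphic

namespace UnitaryGroup

open Literature.NumberTheory.Rogawski1990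

variable (L : Type) [Field L] [NumberField L] [IsCMField L] {N : ℕ} {H H' : Matrix (Fin N) (Fin N) L}

/-! ## §1 The projections respect centralisers -/

/-- `f (a b a⁻¹) = f a · f b · (f a)⁻¹` for a group homomorphism (bookkeeping). [cite: BorelJacquet1979, §4.1] -/
theorem monoidHom_map_conj {G G' : Type*} [Group G] [Group G'] (f : G →* G') (a b : G) : f (a * b * a⁻¹) = f a * f b * (f a)⁻¹ := by
  rw [map_mul, map_mul, map_inv]

/-- `z ∈ Z_{U(H)(𝔸)}(g)` ⇒ `z_v ∈ Z_{U(H)(L⁺_v)}(g_v)` (★ `cmDatum.toLocal` is a homomorphism). [cite: Rogawski1990, §4.3 p. 43] -/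
theorem toLocal_mem_centralizer_toLocal (v : HeightOneSpectrum (𝓞 ↥(maximalRealSubfield L))) {g : (cmDatum L N H).Adelic}
    (z : Subgroup.centralizer ({g} : Set (cmDatum L N H).Adelic)) :
    (cmDatum L N H).toLocal v (z : (cmDatum L N H).Adelic) ∈ Subgroup.centralizer ({(cmDatum L N H).toLocal v g} : Set ((cmDatum L N H).Local v)) :=
  Subgroup.mem_centralizer_singleton_iff.mpr (by
    rw [← map_mul, ← map_mul, Subgroup.mem_centralizer_singleton_iff.mp z.2])

/-- `z ∈ Z_{U(H)(𝔸)}(γ ⊗ 1)` ⇒ `z_∞ ∈ Z_{U(H)(L⁺ ⊗ ℝ)}(γ ⊗ 1)` (★ `archPart` is a homomorphism and `(γ ⊗ 1)_∞ = cmRationalToArch γ`, ★ `archPart_cmDatum_toAdelic`).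
[cite: BorelJacquet1979, §4.1] -/
theorem archPart_mem_centralizer_cmRationalToArch {γ : (cmDatum L N H).Rational}
    (z : Subgroup.centralizer ({(cmDatum L N H).toAdelic γ} : Set (cmDatum L N H).Adelic)) :
    archPart (↥(maximalRealSubfield L)) L (IsCMField.complexConj L) N H (z : (cmDatum L N H).Adelic) ∈
      Subgroup.centralizer ({cmRationalToArch L N H γ} : Set (arch (↥(maximalRealSubfield L)) L (IsCMField.complexConj L) N H)) := by
  rw [← archPart_cmDatum_toAdelic]
  have hz : (z : (cmDatum L N H).Adelic) * (cmDatum L N H).toAdelic γ = (cmDatum L N H).toAdelic γ * (z : (cmDatum L N H).Adelic) :=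
    Subgroup.mem_centralizer_singleton_iff.mp z.2
  refine Subgroup.mem_centralizer_singleton_iff.mpr (Subtype.ext ?_)
  change GLn.toMixed N L (z : (cmDatum L N H).Adelic).val * GLn.toMixed N L ((cmDatum L N H).toAdelic γ).val =
    GLn.toMixed N L ((cmDatum L N H).toAdelic γ).val * GLn.toMixed N L (z : (cmDatum L N H).Adelic).val
  rw [← map_mul, ← map_mul]
  exact congrArg (GLn.toMixed N L) (congrArg Subtype.val hz)

/-- On invertible matrices: `(cmRationalToArch γ)` is the archimedean component of `γ ⊗ 1 = toAdeleGL γ` (★ `GLn.toMixed`). [cite: BorelJacquet1979, §4.1] -/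
theorem toMixed_toAdeleGL_eq_coe_cmRationalToArch (γ : (cmDatum L N H).Rational) :
    GLn.toMixed N L (toAdeleGL L (γ.val : GL (Fin N) L)) =
      ((cmRationalToArch L N H γ : arch (↥(maximalRealSubfield L)) L (IsCMField.complexConj L) N H) : GL (Fin N) (mixedEmbedding.mixedSpace L)) := by
  rw [← archPart_cmDatum_toAdelic]
  rfl

/-! ## §2 `(e_𝔸 z)_v = e_v (z_v)` at every finite place -/

/-- **The adelic stable-centraliser isomorphism is the local one on `v`-components**: for rational `γ ↔ γ′` (`γ` regular, `det H, det H′ ≠ 0`) and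
`z ∈ Z_{U(H)(𝔸)}(γ ⊗ 1)`, the `v`-component of `adelicStableCentralizerEquiv z` is `localStableCentralizerEquiv` (for the localised correspondence
★ `corresponds_toLocal_toAdelic`, at the `v`-component `(γ ⊗ 1)_v`, assumed regular) applied to `z_v` — both are conjugation by `(y ⊗ 1)_v` for any rational
conjugator `y` of `γ` to `γ′`. [cite: Rogawski1990, §4.3 pp. 43–44] -/
theorem toLocal_adelicStableCentralizerEquiv (hH : H.det ≠ 0) (hH' : H'.det ≠ 0) {γ : (cmDatum L N H).Rational} {γ' : (cmDatum L N H').Rational}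
    (hc : Corresponds (cmConjRingHom L) H H' γ γ') (hreg : IsRegularElt (γ.val : GL (Fin N) L)) (v : HeightOneSpectrum (𝓞 ↥(maximalRealSubfield L)))
    (hregv : IsRegularElt (((cmDatum L N H).toLocal v ((cmDatum L N H).toAdelic γ)).val : GL (Fin N) (LocalRing L v)))
    (z : Subgroup.centralizer ({(cmDatum L N H).toAdelic γ} : Set (cmDatum L N H).Adelic)) :
    (cmDatum L N H').toLocal v ((adelicStableCentralizerEquiv L hH hH' hc hreg z :
        Subgroup.centralizer ({(cmDatum L N H').toAdelic γ'} : Set (cmDatum L N H').Adelic)) : (cmDatum L N H').Adelic) =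
      ((localStableCentralizerEquiv L v hH hH' (corresponds_toLocal_toAdelic hc v) hregv
          ⟨(cmDatum L N H).toLocal v (z : (cmDatum L N H).Adelic), toLocal_mem_centralizer_toLocal L v z⟩ :
        Subgroup.centralizer ({(cmDatum L N H').toLocal v ((cmDatum L N H').toAdelic γ')} : Set ((cmDatum L N H').Local v))) :
        (cmDatum L N H').Local v) := by
  -- a rational conjugator `y`, its adelic and local images
  set y : GL (Fin N) L := hc.conjugator with hy_def
  have hy : y * (γ.val : GL (Fin N) L) * y⁻¹ = γ'.val := hc.conjugator_spec
  set yv : GL (Fin N) (LocalRing L v) := Matrix.GeneralLinearGroup.map (adeleToLocal L v) (toAdeleGL L y) with hyv_def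
  have hyv : yv * (((cmDatum L N H).toLocal v ((cmDatum L N H).toAdelic γ)).val : GL (Fin N) (LocalRing L v)) * yv⁻¹ =
      ((cmDatum L N H').toLocal v ((cmDatum L N H').toAdelic γ')).val := by
    rw [coe_cmDatum_toLocal, coe_cmDatum_toLocal, coe_cmDatum_toAdelic, coe_cmDatum_toAdelic, hyv_def, ← map_inv, ← map_mul, ← map_mul,
      ← map_inv, ← map_mul, ← map_mul, hy]
  apply Subtype.ext
  have h1 := coe_adelicStableCentralizerEquiv_eq_of_conj_eq L hH hH' hc hreg y hy z
  have h2 := coe_localStableCentralizerEquiv_eq_of_conj_eq L v hH hH' (corresponds_toLocal_toAdelic hc v) hregv yv hyv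
    ⟨(cmDatum L N H).toLocal v (z : (cmDatum L N H).Adelic), toLocal_mem_centralizer_toLocal L v z⟩
  calc (((cmDatum L N H').toLocal v ((adelicStableCentralizerEquiv L hH hH' hc hreg z :
          Subgroup.centralizer ({(cmDatum L N H').toAdelic γ'} : Set (cmDatum L N H').Adelic)) : (cmDatum L N H').Adelic)).val :
          GL (Fin N) (LocalRing L v))
        = Matrix.GeneralLinearGroup.map (adeleToLocal L v) (toAdeleGL L y * (z : (cmDatum L N H).Adelic).val * (toAdeleGL L y)⁻¹) :=
          congrArg (Matrix.GeneralLinearGroup.map (adeleToLocal L v)) h1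
    _ = yv * Matrix.GeneralLinearGroup.map (adeleToLocal L v) (z : (cmDatum L N H).Adelic).val * yv⁻¹ := monoidHom_map_conj _ _ _
    _ = _ := h2.symm

/-! ## §3 `(e_𝔸 z)_∞ = e_∞ (z_∞)` at infinity -/

/-- **The adelic stable-centraliser isomorphism is the archimedean one on `∞`-components**: for rational `γ ↔ γ′` (`γ` regular, `det H, det H′ ≠ 0`) and
`z ∈ Z_{U(H)(𝔸)}(γ ⊗ 1)`, the archimedean component (★ `archPart`) of `adelicStableCentralizerEquiv z` is `archStableCentralizerEquiv` (for
★ `corresponds_cmRationalToArch`, at `γ ⊗ 1 = cmRationalToArch γ`, assumed regular) applied to `z_∞` — both are conjugation by `(y ⊗ 1)_∞`.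
[cite: Rogawski1990, §4.3 pp. 43–44; §14.2 p. 232] -/
theorem archPart_adelicStableCentralizerEquiv (hH : H.det ≠ 0) (hH' : H'.det ≠ 0) {γ : (cmDatum L N H).Rational} {γ' : (cmDatum L N H').Rational}
    (hc : Corresponds (cmConjRingHom L) H H' γ γ') (hreg : IsRegularElt (γ.val : GL (Fin N) L))
    (hreginf : IsRegularElt ((cmRationalToArch L N H γ : arch (↥(maximalRealSubfield L)) L (IsCMField.complexConj L) N H).val))
    (z : Subgroup.centralizer ({(cmDatum L N H).toAdelic γ} : Set (cmDatum L N H).Adelic)) :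
    archPart (↥(maximalRealSubfield L)) L (IsCMField.complexConj L) N H'
        ((adelicStableCentralizerEquiv L hH hH' hc hreg z :
          Subgroup.centralizer ({(cmDatum L N H').toAdelic γ'} : Set (cmDatum L N H').Adelic)) : (cmDatum L N H').Adelic) =
      ((archStableCentralizerEquiv L hH hH' (corresponds_cmRationalToArch hc) hreginf
          ⟨archPart (↥(maximalRealSubfield L)) L (IsCMField.complexConj L) N H (z : (cmDatum L N H).Adelic),
            archPart_mem_centralizer_cmRationalToArch L z⟩ :
        Subgroup.centralizer ({cmRationalToArch L N H' γ'} : Set (arch (↥(maximalRealSubfield L)) L (IsCMField.complexConj L) N H'))) :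
        arch (↥(maximalRealSubfield L)) L (IsCMField.complexConj L) N H') := by
  set y : GL (Fin N) L := hc.conjugator with hy_def
  have hy : y * (γ.val : GL (Fin N) L) * y⁻¹ = γ'.val := hc.conjugator_spec
  set yi : GL (Fin N) (mixedEmbedding.mixedSpace L) := GLn.toMixed N L (toAdeleGL L y) with hyi_def
  have hyi : yi * ((cmRationalToArch L N H γ : arch (↥(maximalRealSubfield L)) L (IsCMField.complexConj L) N H).val) * yi⁻¹ =
      (cmRationalToArch L N H' γ' : arch (↥(maximalRealSubfield L)) L (IsCMField.complexConj L) N H').val := by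
    rw [← toMixed_toAdeleGL_eq_coe_cmRationalToArch, ← toMixed_toAdeleGL_eq_coe_cmRationalToArch, hyi_def, ← map_inv, ← map_mul, ← map_mul,
      ← map_inv, ← map_mul, ← map_mul, hy]
  apply Subtype.ext
  have h1 := coe_adelicStableCentralizerEquiv_eq_of_conj_eq L hH hH' hc hreg y hy z
  have h2 := coe_archStableCentralizerEquiv_eq_of_conj_eq L hH hH' (corresponds_cmRationalToArch hc) hreginf yi hyi
    ⟨archPart (↥(maximalRealSubfield L)) L (IsCMField.complexConj L) N H (z : (cmDatum L N H).Adelic), archPart_mem_centralizer_cmRationalToArch L z⟩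
  calc ((archPart (↥(maximalRealSubfield L)) L (IsCMField.complexConj L) N H'
          ((adelicStableCentralizerEquiv L hH hH' hc hreg z :
            Subgroup.centralizer ({(cmDatum L N H').toAdelic γ'} : Set (cmDatum L N H').Adelic)) : (cmDatum L N H').Adelic)).val :
          GL (Fin N) (mixedEmbedding.mixedSpace L))
        = GLn.toMixed N L (toAdeleGL L y * (z : (cmDatum L N H).Adelic).val * (toAdeleGL L y)⁻¹) := congrArg (GLn.toMixed N L) h1
    _ = yi * GLn.toMixed N L (z : (cmDatum L N H).Adelic).val * yi⁻¹ := monoidHom_map_conj _ _ _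
    _ = _ := h2.symm

end UnitaryGroup

end Literature.NumberTheory.Automorphic
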